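import Summits.AtomisticToContinuum.HydrodynamicLimit.Theorems.RelayRaceLocalityRestartPrincipleStubMeanClosure
import Summits.AtomisticToContinuum.HydrodynamicLimit.Theorems.RelayRaceLocalityRestartPrincipleOfConjunct
import Summits.AtomisticToContinuum.HydrodynamicLimit.Theorems.RelayRaceLocalityRestartPrincipleMeanOfConjunct
import HarnessLib

/-!
# Crux `RestartPrinciple` (stmt-AtomisticToContinuum-12503), line `IdeatorFourSketch` — the crux from the mean hydrodynamic limit ALONE

Support file (`--supports stmt-AtomisticToContinuum-12503`; registered sub-goal `restartPrinciple_of_meanHydroLimitInBand`, filed by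
lead a2, landed by lead c10). With `MeanClosure` (stmt-AtomisticToContinuum-11929) PROVED under this crux
(`AgeDuhamelForgetting.meanClosure_holds`, p128739) the dock `restartPrinciple_of_meanProgramme` (p132793) needs only the mean
hydrodynamic limit in the dilute band, stmt-AtomisticToContinuum-11927 `ResponseRigidity.MeanHydroLimitInBand`; conversely the
(re-typed, packing-guarded) conjunct implies it (`meanHydroLimitInBand_of_hydrodynamicLimit`, p132945). Hence, every arrow a landed
name: `HydrodynamicLimit ↔ MeanHydroLimitInBand` and `MeanHydroLimitInBand → RestartPrinciple` — the crux, the sub-problem conjunct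
and item 11927 coincide modulo the idle antecedent `S` (`RestartPrinciple ↔ (S → HydrodynamicLimit)` by `Iff.rfl`).
Bookkeeping only; no definitions.
-/

namespace Summit.AtomisticToContinuum.HydrodynamicLimit.Theorems.RestartPrinciple

open Summit.AtomisticToContinuum.HydrodynamicLimit.Theses
open Summit.AtomisticToContinuum.HydrodynamicLimit.Theses.RelayRaceLocality

/-- **The crux from stmt-AtomisticToContinuum-11927 alone** (registered sub-goal of lead a2): the mean hydrodynamic limit in the
dilute band implies `RestartPrinciple`, the mean closure (stmt-11929) being proved (`meanClosure_holds`, p128739). -/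
theorem restartPrinciple_of_meanHydroLimitInBand : ResponseRigidity.MeanHydroLimitInBand → RelayRaceLocality.RestartPrinciple :=
  fun h => restartPrinciple_of_meanProgramme h AgeDuhamelForgetting.meanClosure_holds

/-- **The packing-guarded conjunct from stmt-AtomisticToContinuum-11927 alone**: mean limit in the band + proved mean closure ⇒
`_root_.HydrodynamicLimit`. -/
theorem hydrodynamicLimit_of_meanHydroLimitInBand : ResponseRigidity.MeanHydroLimitInBand → _root_.HydrodynamicLimit :=
  fun h => hydrodynamicLimit_of_meanProgramme h AgeDuhamelForgetting.meanClosure_holds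

/-- **The sub-problem conjunct and the mean hydrodynamic limit in the band are equivalent** (every arrow a landed name:
`meanHydroLimitInBand_of_hydrodynamicLimit` p132945 — uniform integrability from energy conservation; `hydrodynamicLimit_of_meanProgramme`
p132793 with `meanClosure_holds` p128739 — entropy saturation). In particular the live content of crux stmt-12503, of the conjunct and of
item stmt-11927 is one and the same statement. -/
theorem hydrodynamicLimit_iff_meanHydroLimitInBand : _root_.HydrodynamicLimit ↔ ResponseRigidity.MeanHydroLimitInBand :=
  ⟨meanHydroLimitInBand_of_hydrodynamicLimit, hydrodynamicLimit_of_meanHydroLimitInBand⟩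

end Summit.AtomisticToContinuum.HydrodynamicLimit.Theorems.RestartPrinciple
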